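import Summits.RiemannHypothesis.RiemannHypothesis.Theorems.WeilTwoPrimeDeflM80PDef
import Summits.RiemannHypothesis.RiemannHypothesis.Theorems.WeilTwoPrimeDeflM80PDataPE33
import Literature.NumberTheory.LFunctions.WeilBlockRowsR
import HarnessLib

/-!
# Even-sector deflated two-prime certificate M80P: the materialized even block agrees with `P_r + Σ μ ĉ ĉᵀ`, rows 110–119

`WeilCert.checkPmRowG` for certificate M80P (even block), by `decide +kernel`. Pure proof file; nothing is asserted.
-/

set_option linter.dupNamespace false

noncomputable section

namespace Summit.RiemannHypothesis.RiemannHypothesis.Theorems.EvenWinsBeyondArch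

open Literature.NumberTheory.LFunctions

set_option maxHeartbeats 0 in
/-- Row 110 of the materialized even block is row 110 of `P_r + Σ μ ĉ ĉᵀ` (certificate M80P). [folklore] -/
theorem checkPmRowG0_110_weilCertDeflM80P : weilCertDeflM80PBase.checkPmRowG weilCertDeflM80PP weilCertDeflM80PPmE 0 110 = true := by
  decide +kernel

set_option maxHeartbeats 0 in
/-- Row 111 of the materialized even block is row 111 of `P_r + Σ μ ĉ ĉᵀ` (certificate M80P). [folklore] -/
theorem checkPmRowG0_111_weilCertDeflM80P : weilCertDeflM80PBase.checkPmRowG weilCertDeflM80PP weilCertDeflM80PPmE 0 111 = true := by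
  decide +kernel

set_option maxHeartbeats 0 in
/-- Row 112 of the materialized even block is row 112 of `P_r + Σ μ ĉ ĉᵀ` (certificate M80P). [folklore] -/
theorem checkPmRowG0_112_weilCertDeflM80P : weilCertDeflM80PBase.checkPmRowG weilCertDeflM80PP weilCertDeflM80PPmE 0 112 = true := by
  decide +kernel

set_option maxHeartbeats 0 in
/-- Row 113 of the materialized even block is row 113 of `P_r + Σ μ ĉ ĉᵀ` (certificate M80P). [folklore] -/
theorem checkPmRowG0_113_weilCertDeflM80P : weilCertDeflM80PBase.checkPmRowG weilCertDeflM80PP weilCertDeflM80PPmE 0 113 = true := by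
  decide +kernel

set_option maxHeartbeats 0 in
/-- Row 114 of the materialized even block is row 114 of `P_r + Σ μ ĉ ĉᵀ` (certificate M80P). [folklore] -/
theorem checkPmRowG0_114_weilCertDeflM80P : weilCertDeflM80PBase.checkPmRowG weilCertDeflM80PP weilCertDeflM80PPmE 0 114 = true := by
  decide +kernel

set_option maxHeartbeats 0 in
/-- Row 115 of the materialized even block is row 115 of `P_r + Σ μ ĉ ĉᵀ` (certificate M80P). [folklore] -/
theorem checkPmRowG0_115_weilCertDeflM80P : weilCertDeflM80PBase.checkPmRowG weilCertDeflM80PP weilCertDeflM80PPmE 0 115 = true := by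
  decide +kernel

set_option maxHeartbeats 0 in
/-- Row 116 of the materialized even block is row 116 of `P_r + Σ μ ĉ ĉᵀ` (certificate M80P). [folklore] -/
theorem checkPmRowG0_116_weilCertDeflM80P : weilCertDeflM80PBase.checkPmRowG weilCertDeflM80PP weilCertDeflM80PPmE 0 116 = true := by
  decide +kernel

set_option maxHeartbeats 0 in
/-- Row 117 of the materialized even block is row 117 of `P_r + Σ μ ĉ ĉᵀ` (certificate M80P). [folklore] -/
theorem checkPmRowG0_117_weilCertDeflM80P : weilCertDeflM80PBase.checkPmRowG weilCertDeflM80PP weilCertDeflM80PPmE 0 117 = true := by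
  decide +kernel

set_option maxHeartbeats 0 in
/-- Row 118 of the materialized even block is row 118 of `P_r + Σ μ ĉ ĉᵀ` (certificate M80P). [folklore] -/
theorem checkPmRowG0_118_weilCertDeflM80P : weilCertDeflM80PBase.checkPmRowG weilCertDeflM80PP weilCertDeflM80PPmE 0 118 = true := by
  decide +kernel

set_option maxHeartbeats 0 in
/-- Row 119 of the materialized even block is row 119 of `P_r + Σ μ ĉ ĉᵀ` (certificate M80P). [folklore] -/
theorem checkPmRowG0_119_weilCertDeflM80P : weilCertDeflM80PBase.checkPmRowG weilCertDeflM80PP weilCertDeflM80PPmE 0 119 = true := by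
  decide +kernel


end Summit.RiemannHypothesis.RiemannHypothesis.Theorems.EvenWinsBeyondArch
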